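import Mathlib.Analysis.Calculus.ContDiff.Defs
import Mathlib.Analysis.Calculus.Deriv.Comp
import Mathlib.Analysis.Calculus.Deriv.Mul
import Mathlib.MeasureTheory.Integral.Bochner.Basic
import Literature.Probability.RandomPlanarGeometry.ChordalCurveFamily
import Literature.Probability.RandomPlanarGeometry.SLE
import HarnessLib

/-!
# First-order deformations (tangent vectors) of chordal curve families; the tangent cone at SLE₆

Topic `Literature/Probability/RandomPlanarGeometry` (definition item `defn-TangentAtSLE6`, request
D1 of route CardyAnchoredRigidity of `CriticalPhenomena/CardyFormulaZ2`; serves its informal items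
SectorExhaustion, GermSignLemma, LinearisedRigidityIsolates).

First-order calculus of chordal families `P : DobrushinDomain → Measure (CurveClass ℂ)` INSIDE a
class `𝒞 : Set ChordalFamily` (e.g. `mirrorLocalMarkovClass`) at a base family `P₀` (e.g. a family
of chordal SLE₆ laws), along a class `𝒯` of test observables `f : CurveClass ℂ → ℝ`:

* `ChordalFamily.Deformation` — the ambient real vector space of first-order deformations
  `D ↦ (f ↦ Ṗ_D f)` (a Pi type: "sums of sectors" are sums here, whatever produced the summands —
  push-forwards along non-conformal homeomorphisms, changes of the driving measure, singular
  perturbations all act on the same coordinates `coord P D f = ∫ f d(P D)`);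
* `ChordalFamily.IsDeformationCurve 𝒞 𝒯 P₀ c` — `c : ℝ → ChordalFamily`, `c 0 = P₀`, `c ε ∈ 𝒞`
  near `0`, every test coordinate `ε ↦ ∫ f d(c ε D)` (`f ∈ 𝒯`) `C¹` near `0`;
  `ChordalFamily.velocity 𝒯 c` — `Ṗ_D f = d/dε|₀ ∫ f d(c ε D)` for `f ∈ 𝒯`, `0` for `f ∉ 𝒯`;
* `ChordalFamily.tangentCone 𝒞 P₀ 𝒯` (all such velocities), `sleTangentCone κ 𝒞 𝒯` (base family
  = chordal SLE_κ laws, `∀ D, IsSLELaw κ D (P₀ D)`), and the requested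
  `TangentAtSLE6 𝒞 = sleTangentCone 6 𝒞 smoothExitCylinders`;
* `smoothExitCylinders` — "smooth cylinder functions of curves stopped at exits of balls":
  `f γ = φ (exitPoint z₁ r₁ γ, …, exitPoint zₙ rₙ γ)`, `φ ∈ C_b^∞` (`CurveClass.exitPoint z r γ` =
  endpoint of the initial segment of `γ` stopped on first leaving `B(z, r)`);
* the LINEARISED AXIOMS of `ChordalCurveFamily.lean` as predicates on a deformation `v`:
  `Deformation.IsCovariantUnder 𝒯 v φ` (`IsSimilarityCovariant`, `IsMirrorCovariant`),
  `IsLocal 𝒯`, `IsTargetIndependent 𝒯`, `IsChordal 𝒯`, `IsMarkovLinearisation P₀ Q₀ 𝒯 v w`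
  (clauses (a)–(c) of `IsMarkovExtension` differentiated; (b) = product rule; `w` deforms `Q₀`);
* measure level: `ChordalFamily.IsMirrorCovariant` (the conjugation clause carried inline in
  `IsometryCovariance.lean` / `LatticeSimilarityCovariance.lean`) and `mirrorLocalMarkovClass`.

API: the cone contains `0`, is stable under real scalings and `v ↦ -v`, is monotone in `𝒞`;
`IsDeformationCurve.hasDerivAt`; the statement form `H1VanishesAtSLE6 𝒞` ("`H¹_𝒞(SLE₆) = 0`").
Mass conservation (`Ṗ_D 1 = 0` along probability laws), the linearised covariance of velocities
of covariant curves, a non-zero tangent vector (mass scaling) and `0 ∈ TangentAtSLE6 𝒞` from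
`exists_isSLECurve` are theorems of `TangentAtSLE6Proofs.lean`; the sectors of the request
(twists, driver drifts / diffusivity, singular driver perturbations): `TangentAtSLE6Sectors.lean`.

## Design notes (faithfulness; what is NOT here)

* Analogy, not source: the "tangent set of a model at `P₀`" (derivatives at `0` of one-dimensional
  differentiable submodels `t ↦ P_t`, Ghosal–van der Vaart 2017 §12.3) / the kinematic tangent
  cone of a subset (velocities of `C¹` curves in it), with the derivative recorded as a functional
  `f ↦ d/dε ∫ f dP^ε` on test observables rather than a score in `L²(P₀)` — quasiconformal twists
  of SLE₆ are mutually singular with `P₀` and have no score. Test observables follow the smooth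
  cylinder functionals `f(W(h₁), …, W(hₙ))`, `f ∈ C_b^∞`, of Malliavin calculus (Nualart 1995
  §1.2, class `S_b`) with exit points from balls as coordinates (Werner 2007 §3.7, `σ_z`).
* "C¹ curve" is read coordinatewise near `0` (`ContDiffAt ℝ 1`); only the derivative at `0`
  enters. Curves are two-sided, so the cone is symmetric; one-sided cones are not defined.
* `𝒯` is a PARAMETER except in `TangentAtSLE6`, which fixes the class the request names.
  `smoothExitCylinders` is not closed under the Markov splitting `g(γ.stopAt F) · h(γ.startFrom F)`;
  statements needing that take a larger `𝒯`. Whether a given deformation curve IS `C¹` along `𝒯`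
  is the hypothesis `IsDeformationCurve.contDiffAt`, never asserted here.
* The SECTORS of the request (target-anchored Beltrami twists, Cameron–Martin drifts /
  diffusivity of the driver, singular perturbations) are families of deformation curves whose
  velocities all live in `Deformation` (what "sum of sectors" needs); see `TangentAtSLE6Sectors`.
* Normalisation `Ṗ_D f = 0` off `𝒯` makes `v = 0` mean "all test derivatives vanish"
  (`H¹_𝒞(SLE₆) = 0` reads `∀ v ∈ TangentAtSLE6 𝒞, v = 0`); accordingly all linearised clauses are
  stated for test observables `f ∈ 𝒯` (with "`f` is an observable of the stopped curve" expressed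
  semantically, `f (γ.stopAt F) = f γ` for curves from `a`, not as `g ∘ stopAt F`).
* No existence/uniqueness of SLE₆ families is claimed: `sleTangentCone` quantifies over `P₀` with
  `∀ D, IsSLELaw κ D (P₀ D)` (unique by the fact `IsSLECurve.map_eq`, cf. `exists_isSLECurve`).

## Sources

W. Werner, *Lectures on two-dimensional critical percolation* (2007), §3.2 (the axioms), §3.7;
G. Lawler, O. Schramm, W. Werner, Acta Math. 187 (2001) §2, Cor. 2.3–2.4; S. Ghosal, A. van der
Vaart, *Fundamentals of Nonparametric Bayesian Inference* (2017) §12.3 (tangent space via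
submodels); D. Nualart, *The Malliavin Calculus and Related Topics* (1995) §1.2 (`S_b`).
Mathlib: `deriv`, `ContDiffAt`, `Filter.EventuallyEq.deriv_eq`, `deriv_comp_mul_left`,
`Set.indicator`; Mathlib's `tangentConeAt` (Bouligand cone in a normed space) does not apply to
`DobrushinDomain → Measure _`. Tree: `ChordalFamily` + axioms, `CurveClass.stopAt / startFrom /
map`, `MarkedDomain.map / chord / arc`, `similarity`, `remainingDomain`,
`IsLocalMarkovChordalFamily` (ChordalCurveFamily); `IsSLELaw` (SLE); the conjugation homeomorphism
`Complex.conjLIE.toHomeomorph` as in `LatticeSimilarityCovariance` / `IsometryCovariance`. Searched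
`lean search 'TangentAt|Deformation|tangentCone|MirrorCovariant|exitPoint'`: no deformation /
tangent notion for families of measures, no exit-point observable and no named mirror-covariance
clause in Mathlib/Literature.
-/

noncomputable section

open Set MeasureTheory Topology Filter
open scoped NNReal ENNReal

namespace Literature.Probability.RandomPlanarGeometry

/-! ### Exit points and smooth cylinder observables -/

namespace CurveClass

/-- The **exit point** of a curve class from the open ball `B(z, r)`: the endpoint of its initial
segment stopped at the first hitting of the closed set `B(z, r)ᶜ` (`CurveClass.stopAt`) — the
first point of the curve outside the ball, or the endpoint of the whole curve if it never leaves
the ball (convention of `stopAt`; computed, like `stopAt`, through the chosen representative —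
representative independence is the named fact `CurveClass.stopAt_mk`). Werner 2007 §3.7 (hitting
data of small discs `σ_z`). [folklore] -/
def exitPoint (z : ℂ) (r : ℝ) (γ : CurveClass ℂ) : ℂ :=
  (γ.stopAt (Metric.ball z r)ᶜ).target

end CurveClass

/-- A function on `n` complex variables is **smooth with bounded derivatives of all orders**
(`C_b^∞`, as a real-smooth function on `Fin n → ℂ ≅ ℝ^{2n}`). Nualart 1995 §1.2 (`C_b^∞(ℝⁿ)`).
[folklore] -/
def IsSmoothBounded {n : ℕ} (φ : (Fin n → ℂ) → ℝ) : Prop :=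
  ContDiff ℝ ((⊤ : ℕ∞) : WithTop ℕ∞) φ ∧ ∀ k : ℕ, ∃ C : ℝ, ∀ x, ‖iteratedFDeriv ℝ k φ x‖ ≤ C

/-- **Smooth cylinder observables of curves stopped at exits of balls**: the functions
`γ ↦ φ (exitPoint z₁ r₁ γ, …, exitPoint zₙ rₙ γ)` of finitely many exit points (radii `rᵢ > 0`)
through a `C_b^∞` function `φ` — the analogue, with exit points as coordinates, of the smooth
cylinder functionals `f(W(h₁), …, W(hₙ))`, `f ∈ C_b^∞` (Nualart 1995 §1.2, class `S_b`).
Constants are the case `n = 0`. This is the test class fixed by `TangentAtSLE6`. [folklore] -/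
def smoothExitCylinders : Set (CurveClass ℂ → ℝ) :=
  {f | ∃ (n : ℕ) (z : Fin n → ℂ) (r : Fin n → ℝ) (φ : (Fin n → ℂ) → ℝ),
    (∀ i, 0 < r i) ∧ IsSmoothBounded φ ∧
      f = fun γ => φ (fun i => CurveClass.exitPoint (z i) (r i) γ)}

/-- Constant observables are smooth cylinder observables (`n = 0`). [folklore] -/
theorem const_mem_smoothExitCylinders (a : ℝ) : (fun _ => a) ∈ smoothExitCylinders := by
  refine ⟨0, Fin.elim0, Fin.elim0, fun _ => a, fun i => i.elim0, ⟨contDiff_const, fun k => ?_⟩,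
    rfl⟩
  refine ⟨‖iteratedFDeriv ℝ k (fun _ : Fin 0 → ℂ => a) 0‖, fun x => ?_⟩
  rw [Subsingleton.elim x 0]

namespace ChordalFamily

/-! ### Mirror covariance (measure level) and the class of the request -/

/-- **Mirror (reflection) covariance** of a chordal family: `P (D̄; ā, b̄) = conj_* (P (D; a, b))`
for every Dobrushin domain, complex conjugation acting as the plane homeomorphism
`Complex.conjLIE.toHomeomorph`. This is the conjugation clause carried inline as `hconj` in
`IsometryCovariance.lean` and as clause (b) of `IsLatticeSimilarityCovariant` — the covariance form
of Werner's symmetry condition (3). [cite: Werner2007, §3.2 (3)] -/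
def IsMirrorCovariant (P : ChordalFamily) : Prop :=
  ∀ D : DobrushinDomain,
    P (D.map Complex.conjLIE.toHomeomorph) =
      (P D).map (CurveClass.map (Complex.conjLIE.toHomeomorph : C(ℂ, ℂ)))

/-- The class `𝒞` of the request: chordal, similarity covariant, domain Markov (with the SET
clause (c) of `IsMarkovExtension`), local (restriction form), target independent (splitting form)
— the bundle `IsLocalMarkovChordalFamily` — and mirror covariant. [folklore] -/
def mirrorLocalMarkovClass : Set ChordalFamily :=
  {P | IsLocalMarkovChordalFamily P ∧ P.IsMirrorCovariant}

/-! ### Deformations, coordinates, deformation curves, velocities -/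

/-- The ambient real vector space of **first-order deformations** of chordal families: for every
Dobrushin domain `D` a functional `f ↦ Ṗ_D f` on observables `f : CurveClass ℂ → ℝ` (intended:
`Ṗ_D f = d/dε|₀ ∫ f d(P^ε D)` on a test class, `0` elsewhere); a Pi type, sums are pointwise.
[folklore] -/
abbrev Deformation : Type := DobrushinDomain → (CurveClass ℂ → ℝ) → ℝ

/-- The **coordinate** of the family `P` at `(D, f)`: `∫ f d(P D)` (Bochner integral; `0` if `f`
is not `P D`-integrable). [folklore] -/
def coord (P : ChordalFamily) (D : DobrushinDomain) (f : CurveClass ℂ → ℝ) : ℝ :=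
  ∫ γ, f γ ∂(P D)

/-- A **deformation curve of `P₀` inside `𝒞`, `C¹` along the test class `𝒯`**: a one-parameter
family `c : ℝ → ChordalFamily` with `c 0 = P₀`, `c ε ∈ 𝒞` for all `ε` in a neighbourhood of `0`,
and every test coordinate `ε ↦ ∫ f d(c ε D)` (`f ∈ 𝒯`) continuously differentiable near `0`
("`C¹` curve `ε ↦ P^ε` in `𝒞` with `P⁰ = P₀`"; Ghosal–van der Vaart 2017 §12.3). [folklore] -/
structure IsDeformationCurve (𝒞 : Set ChordalFamily) (𝒯 : Set (CurveClass ℂ → ℝ))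
    (P₀ : ChordalFamily) (c : ℝ → ChordalFamily) : Prop where
  /-- The curve passes through the base family at `ε = 0`. -/
  eq_base : c 0 = P₀
  /-- The curve stays in the class for small `|ε|`. -/
  eventually_mem : ∀ᶠ ε in 𝓝 (0 : ℝ), c ε ∈ 𝒞
  /-- Test coordinates are `C¹` near `0`. -/
  contDiffAt : ∀ D : DobrushinDomain, ∀ f ∈ 𝒯, ContDiffAt ℝ 1 (fun ε => coord (c ε) D f) 0

/-- The **velocity** (tangent vector) at `ε = 0` of a one-parameter family of chordal families,
along the test class `𝒯`: `Ṗ_D f = d/dε|₀ ∫ f d(c ε D)` for `f ∈ 𝒯`, normalised to `0` for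
`f ∉ 𝒯`. [folklore] -/
def velocity (𝒯 : Set (CurveClass ℂ → ℝ)) (c : ℝ → ChordalFamily) : Deformation :=
  fun D => 𝒯.indicator fun f => deriv (fun ε => coord (c ε) D f) 0

/-- The velocity on a test observable is the derivative of its coordinate. [folklore] -/
theorem velocity_apply_of_mem {𝒯 : Set (CurveClass ℂ → ℝ)} (c : ℝ → ChordalFamily)
    (D : DobrushinDomain) {f : CurveClass ℂ → ℝ} (hf : f ∈ 𝒯) :
    velocity 𝒯 c D f = deriv (fun ε => coord (c ε) D f) 0 :=
  indicator_of_mem hf _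

/-- The velocity vanishes off the test class (normalisation). [folklore] -/
theorem velocity_apply_of_not_mem {𝒯 : Set (CurveClass ℂ → ℝ)} (c : ℝ → ChordalFamily)
    (D : DobrushinDomain) {f : CurveClass ℂ → ℝ} (hf : f ∉ 𝒯) :
    velocity 𝒯 c D f = 0 :=
  indicator_of_notMem hf _

/-- Along a deformation curve every test coordinate has derivative `velocity` at `0`. [folklore] -/
theorem IsDeformationCurve.hasDerivAt {𝒞 : Set ChordalFamily} {𝒯 : Set (CurveClass ℂ → ℝ)}
    {P₀ : ChordalFamily} {c : ℝ → ChordalFamily} (hc : IsDeformationCurve 𝒞 𝒯 P₀ c)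
    (D : DobrushinDomain) {f : CurveClass ℂ → ℝ} (hf : f ∈ 𝒯) :
    HasDerivAt (fun ε => coord (c ε) D f) (velocity 𝒯 c D f) 0 := by
  rw [velocity_apply_of_mem c D hf]
  exact ((hc.contDiffAt D f hf).differentiableAt one_ne_zero).hasDerivAt

/-! ### Tangent cones -/

/-- The **tangent cone of the class `𝒞` at `P₀` along `𝒯`**: the velocities at `0` of all
deformation curves of `P₀` inside `𝒞` that are `C¹` along `𝒯` (kinematic tangent cone; "tangent
set of the model at `P₀`", Ghosal–van der Vaart 2017 §12.3, with functional-valued derivatives).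
A cone, symmetric under `v ↦ -v`, not a linear subspace in general (≠ Mathlib's `tangentConeAt`,
the Bouligand cone in a normed space). [folklore] -/
def tangentCone (𝒞 : Set ChordalFamily) (P₀ : ChordalFamily) (𝒯 : Set (CurveClass ℂ → ℝ)) :
    Set Deformation :=
  {v | ∃ c : ℝ → ChordalFamily, IsDeformationCurve 𝒞 𝒯 P₀ c ∧ velocity 𝒯 c = v}

/-- The **tangent cone of `𝒞` at chordal SLE_κ along `𝒯`**: tangent vectors at a base family
`P₀ ∈ 𝒞` all of whose laws are chordal SLE_κ laws (`IsSLELaw κ D (P₀ D)` for every Dobrushin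
domain `D`; such a family is unique by the named fact `IsSLECurve.map_eq`). [folklore] -/
def sleTangentCone (κ : ℝ≥0) (𝒞 : Set ChordalFamily) (𝒯 : Set (CurveClass ℂ → ℝ)) :
    Set Deformation :=
  {v | ∃ P₀ : ChordalFamily, (∀ D, IsSLELaw κ D (P₀ D)) ∧ v ∈ tangentCone 𝒞 P₀ 𝒯}

/-- **Tangent vectors at SLE₆ inside the class `𝒞`** (definition request D1 of route
CardyAnchoredRigidity): the first-order deformations `Ṗ` of the chordal SLE₆ family inside `𝒞` —
families `D ↦ (f ↦ Ṗ_D f)` of functionals on the smooth cylinder observables of curves stopped at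
exits of balls (`smoothExitCylinders`), arising as `ε`-derivatives at `0` of `C¹` curves
`ε ↦ P^ε` in `𝒞` with `P⁰` the SLE₆ family. "`H¹_𝒞(SLE₆) = 0`" is `H1VanishesAtSLE6 𝒞`
(`TangentAtSLE6 𝒞 ⊆ {0}`). [folklore] -/
def TangentAtSLE6 (𝒞 : Set ChordalFamily) : Set Deformation :=
  sleTangentCone 6 𝒞 smoothExitCylinders

/-- Unfolding `TangentAtSLE6`. [folklore] -/
theorem mem_tangentAtSLE6_iff (𝒞 : Set ChordalFamily) (v : Deformation) :
    v ∈ TangentAtSLE6 𝒞 ↔ ∃ P₀ : ChordalFamily, (∀ D, IsSLELaw 6 D (P₀ D)) ∧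
      ∃ c : ℝ → ChordalFamily, IsDeformationCurve 𝒞 smoothExitCylinders P₀ c ∧
        velocity smoothExitCylinders c = v :=
  Iff.rfl

/-- **`H¹_𝒞(SLE₆) = 0`** (first-order rigidity of SLE₆ inside the class `𝒞`, the statement form
the request names): every tangent vector at SLE₆ inside `𝒞` is zero. [folklore] -/
def H1VanishesAtSLE6 (𝒞 : Set ChordalFamily) : Prop :=
  ∀ v ∈ TangentAtSLE6 𝒞, v = 0

/-! ### Elementary structure of the cone -/

section Cone

variable {𝒞 𝒞' : Set ChordalFamily} {𝒯 : Set (CurveClass ℂ → ℝ)} {P₀ : ChordalFamily}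

/-- The constant curve at `P₀ ∈ 𝒞` is a deformation curve. [folklore] -/
theorem isDeformationCurve_const (h : P₀ ∈ 𝒞) : IsDeformationCurve 𝒞 𝒯 P₀ fun _ => P₀ :=
  ⟨rfl, Eventually.of_forall fun _ => h, fun _ _ _ => contDiffAt_const⟩

/-- The constant curve has velocity `0`. [folklore] -/
theorem velocity_const (𝒯 : Set (CurveClass ℂ → ℝ)) (P₀ : ChordalFamily) :
    velocity 𝒯 (fun _ => P₀) = 0 := by
  funext D f
  by_cases hf : f ∈ 𝒯
  · rw [velocity_apply_of_mem _ D hf]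
    exact deriv_const 0 _
  · exact velocity_apply_of_not_mem _ D hf

/-- `0` is a tangent vector at every `P₀ ∈ 𝒞`. [folklore] -/
theorem zero_mem_tangentCone (h : P₀ ∈ 𝒞) : (0 : Deformation) ∈ tangentCone 𝒞 P₀ 𝒯 :=
  ⟨fun _ => P₀, isDeformationCurve_const h, velocity_const 𝒯 P₀⟩

/-- Reparametrising the curve by `ε ↦ a ε` keeps it a deformation curve. [folklore] -/
theorem IsDeformationCurve.comp_mul {c : ℝ → ChordalFamily} (hc : IsDeformationCurve 𝒞 𝒯 P₀ c)
    (a : ℝ) : IsDeformationCurve 𝒞 𝒯 P₀ fun ε => c (a * ε) := by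
  refine ⟨by simpa using hc.eq_base, ?_, fun D f hf => ?_⟩
  · have h : Tendsto (fun ε : ℝ => a * ε) (𝓝 0) (𝓝 0) := by
      simpa using (continuous_const_mul a).tendsto (0 : ℝ)
    exact h.eventually hc.eventually_mem
  · have h0 : ContDiffAt ℝ 1 (fun ε => coord (c ε) D f) (a * 0) := by
      simpa using hc.contDiffAt D f hf
    exact h0.comp 0 (contDiff_const.mul contDiff_id).contDiffAt

/-- Velocity of the reparametrised curve: `d/dε|₀ c(aε) = a · ċ(0)`. [folklore] -/
theorem velocity_comp_mul {c : ℝ → ChordalFamily} (a : ℝ) :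
    velocity 𝒯 (fun ε => c (a * ε)) = a • velocity 𝒯 c := by
  funext D f
  by_cases hf : f ∈ 𝒯
  · rw [Pi.smul_apply, Pi.smul_apply, velocity_apply_of_mem _ D hf,
      velocity_apply_of_mem _ D hf, deriv_comp_mul_left a (fun ε => coord (c ε) D f) 0,
      mul_zero]
  · rw [Pi.smul_apply, Pi.smul_apply, velocity_apply_of_not_mem _ D hf,
      velocity_apply_of_not_mem _ D hf, smul_zero]

/-- The tangent cone is a cone, symmetric: stable under all real scalings. [folklore] -/
theorem smul_mem_tangentCone {v : Deformation} (hv : v ∈ tangentCone 𝒞 P₀ 𝒯) (a : ℝ) :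
    a • v ∈ tangentCone 𝒞 P₀ 𝒯 := by
  obtain ⟨c, hc, rfl⟩ := hv
  exact ⟨fun ε => c (a * ε), hc.comp_mul a, velocity_comp_mul a⟩

/-- A deformation curve inside a smaller class is one inside a larger class. [folklore] -/
theorem IsDeformationCurve.mono {c : ℝ → ChordalFamily} (hc : IsDeformationCurve 𝒞 𝒯 P₀ c)
    (h : 𝒞 ⊆ 𝒞') : IsDeformationCurve 𝒞' 𝒯 P₀ c :=
  ⟨hc.eq_base, hc.eventually_mem.mono fun _ hε => h hε, hc.contDiffAt⟩

/-- The tangent cone is monotone in the class. [folklore] -/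
theorem tangentCone_mono (h : 𝒞 ⊆ 𝒞') (P₀ : ChordalFamily) (𝒯 : Set (CurveClass ℂ → ℝ)) :
    tangentCone 𝒞 P₀ 𝒯 ⊆ tangentCone 𝒞' P₀ 𝒯 := by
  rintro v ⟨c, hc, rfl⟩
  exact ⟨c, hc.mono h, rfl⟩

end Cone

/-! ### Linearised axioms (predicates on a deformation) -/

/-- A first-order deformation of a Markov extension `Q₀`: for every Dobrushin domain and explored
initial piece a functional on observables of the future. [folklore] -/
abbrev ExtDeformation : Type := DobrushinDomain → CurveClass ℂ → (CurveClass ℂ → ℝ) → ℝ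

namespace Deformation

/-- **Linearised covariance under a plane homeomorphism `φ`** (derivative at `0` of
`P^ε (φ D) = φ_* (P^ε D)` tested on `f`): `Ṗ_{φD} f = Ṗ_D (f ∘ φ_*)` for test observables `f`
with `f ∘ φ_* ∈ 𝒯`. Werner 2007 §3.2 (1), differentiated. [folklore] -/
def IsCovariantUnder (𝒯 : Set (CurveClass ℂ → ℝ)) (v : Deformation) (φ : ℂ ≃ₜ ℂ) : Prop :=
  ∀ (D : DobrushinDomain), ∀ f ∈ 𝒯, f ∘ CurveClass.map (φ : C(ℂ, ℂ)) ∈ 𝒯 →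
    v (D.map φ) f = v D (f ∘ CurveClass.map (φ : C(ℂ, ℂ)))

/-- **Linearised similarity covariance**: covariance of the deformation under every
`z ↦ c z + w`, `c ≠ 0` (derivative of `ChordalFamily.IsSimilarityCovariant`). [folklore] -/
def IsSimilarityCovariant (𝒯 : Set (CurveClass ℂ → ℝ)) (v : Deformation) : Prop :=
  ∀ (a : ℂ) (ha : a ≠ 0) (w : ℂ), v.IsCovariantUnder 𝒯 (similarity a ha w)

/-- **Linearised mirror covariance**: covariance of the deformation under `z ↦ z̄` (derivative of
`ChordalFamily.IsMirrorCovariant`). [folklore] -/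
def IsMirrorCovariant (𝒯 : Set (CurveClass ℂ → ℝ)) (v : Deformation) : Prop :=
  v.IsCovariantUnder 𝒯 Complex.conjLIE.toHomeomorph

/-- **Linearised locality, restriction form** (derivative of `ChordalFamily.IsLocal`, LSW 2001
Cor. 2.4): for Dobrushin domains `D' ⊆ D` with the same marked points, the deformations in `D'`
and in `D` agree on every test observable of the curve STOPPED on `closure (D ∖ D')` (one that
does not change when a curve from `a` is replaced by its stopped initial segment). [folklore] -/
def IsLocal (𝒯 : Set (CurveClass ℂ → ℝ)) (v : Deformation) : Prop :=
  ∀ (D D' : DobrushinDomain), D'.carrier ⊆ D.carrier → D'.pt 0 = D.pt 0 → D'.pt 1 = D.pt 1 →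
    ∀ f ∈ 𝒯, (∀ γ : CurveClass ℂ, γ.source = D.pt 0 →
      f (γ.stopAt (closure (D.carrier \ D'.carrier))) = f γ) → v D' f = v D f

/-- **Linearised target independence, splitting form** (derivative of
`ChordalFamily.IsTargetIndependent`, LSW 2001 Cor. 2.3 / Werner 2007 Prop. 3.4): in `(D; a, b, b')`
the deformations of the laws from `a` to `b` and from `a` to `b'` agree on every test observable
of the curve stopped on the arc `[b, b'] = D.arc 1`. [folklore] -/
def IsTargetIndependent (𝒯 : Set (CurveClass ℂ → ℝ)) (v : Deformation) : Prop :=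
  ∀ (D : MarkedDomain 3), ∀ f ∈ 𝒯,
    (∀ γ : CurveClass ℂ, γ.source = D.pt 0 → f (γ.stopAt (D.arc 1)) = f γ) →
      v (D.chord 0 1 (by decide)) f = v (D.chord 0 2 (by decide)) f

/-- **Linearised chordality** (derivative of `ChordalFamily.IsChordal`): total mass is conserved,
`Ṗ_D 1 = 0`, and `Ṗ_D` sees test observables only through their values on the chordal curves of
`D` (curves in `D̄` from `a` to `b`). [folklore] -/
def IsChordal (𝒯 : Set (CurveClass ℂ → ℝ)) (v : Deformation) : Prop :=
  ∀ D : DobrushinDomain, v D (fun _ => 1) = 0 ∧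
    ∀ f ∈ 𝒯, ∀ g ∈ 𝒯, (∀ γ : CurveClass ℂ, γ.source = D.pt 0 → γ.target = D.pt 1 →
      γ.range ⊆ closure D.carrier → f γ = g γ) → v D f = v D g

/-- **Linearised domain Markov property**: `(v, w)` is a first-order deformation of the pair
`(P₀, Q₀)` of a family and a Markov extension (`ChordalFamily.IsMarkovExtension P₀ Q₀`) — the
formal `ε`-derivative at `0` of clauses (a)–(c) along a curve `(P^ε, Q^ε)` of such pairs:
* `initial` — (a): with nothing explored, `w D (const a) = v D`;
* `markov` — (b), for a test observable written through the splitting at the closed set `F`,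
  `f γ = k (γ|F) (γ|^F)` (`γ|F = stopAt F γ`, `γ|^F = startFrom F γ`), so that
  `P_D[f] = P_D[f̄]` with `f̄ γ = Q_D(γ|F)[k (γ|F)]`; differentiated by the product rule:
  `Ṗ_D f = Ṗ_D f̄ + P₀_D[ Q̇_D(γ|F)[k (γ|F)] ]` (guard: `f̄ ∈ 𝒯`);
* `domain` — (c): `w D past` depends only on the remaining marked domain
  `(remainingDomain D past; past.target, D.pt 1)` (the SET clause).
Werner 2007 §3.2 (2), differentiated. [folklore] -/
structure IsMarkovLinearisation (P₀ : ChordalFamily)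
    (Q₀ : DobrushinDomain → CurveClass ℂ → Measure (CurveClass ℂ)) (𝒯 : Set (CurveClass ℂ → ℝ))
    (v : Deformation) (w : ExtDeformation) : Prop where
  /-- (a) differentiated. -/
  initial : ∀ D : DobrushinDomain, w D (CurveClass.mk (Curve.const (D.pt 0))) = v D
  /-- (b) differentiated (product rule), on test observables. -/
  markov : ∀ (D : DobrushinDomain) (F : Set ℂ), IsClosed F →
    ∀ f ∈ 𝒯, ∀ k : CurveClass ℂ → CurveClass ℂ → ℝ,
      (∀ γ : CurveClass ℂ, f γ = k (γ.stopAt F) (γ.startFrom F)) →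
      (fun γ => ∫ η, k (γ.stopAt F) η ∂(Q₀ D (γ.stopAt F))) ∈ 𝒯 →
        v D f = v D (fun γ => ∫ η, k (γ.stopAt F) η ∂(Q₀ D (γ.stopAt F))) +
          ∫ γ, w D (γ.stopAt F) (k (γ.stopAt F)) ∂(P₀ D)
  /-- (c) differentiated: dependence on the remaining marked domain only. -/
  domain : ∀ (D₁ D₂ : DobrushinDomain) (p₁ p₂ : CurveClass ℂ),
    remainingDomain D₁ p₁ = remainingDomain D₂ p₂ → p₁.target = p₂.target → D₁.pt 1 = D₂.pt 1 →
      w D₁ p₁ = w D₂ p₂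

end Deformation

end ChordalFamily

end Literature.Probability.RandomPlanarGeometry
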